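import Summits.BirchSwinnertonDyer.BirchSwinnertonDyer.Theorems.AlignedTransportAtTwoMainConjectureOfRankZeroBSDAtTwoHalfDescentLayerIndexGrowthFinite
import Summits.BirchSwinnertonDyer.BirchSwinnertonDyer.Theorems.AlignedTransportAtTwoMainConjectureOfRankZeroBSDAtTwoHalfDescentLayerIndexBounded
import HarnessLib

/-!
# Route `AlignedTransportAtTwo`, crux C2 `MainConjectureOfRankZeroBSDAtTwo` (stmt-BirchSwinnertonDyer-22298):
# THE GROWTH NUMBER AT FINITE LEVEL, IV — COMPLETENESS: `μ(X) = 0` ⟹ the growth numbers `g_n` are eventually positive and bounded (EVERY f.g. torsion `X`,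
# no tower hypothesis); hence, under bounded control (`#ker h_n`, `#ker g_n` finite and bounded up the tower),
# `μ(X(E/K_∞)) = 0 ⟺ ∃ n, 0 < #((conj_{γ^{pⁿ}} − 1)·Sel_{p^∞}(E/K_{n+1})) · #ker g_{n+1} < p^{pⁿ(p−1)}` — the finite-level door is complete

HONEST FRAMING (cell `bsd-f1-sign2`, WIDTH-5 attached prover seat `bsd-line-att-p5` gen 57 on line `birth` of the lead `bsd-line-att-p2`;
`--supports` stmt-BirchSwinnertonDyer-22298, closes nothing; BSD is NOT proved by any of this; the crux C2, its verdict «blocked-on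
`Rank1Residual.GreenbergMuConjectureIrreducible`» and every registered stub (P / T / Kμ / LimDoor / MuIneqʳ / PFμ⁺) are untouched). THEOREMS ONLY — no `def`,
no instance, no named fact, no `sorry`. Route-independent (any number field, any prime `p`, any `ℤ_p`-extension, any Pontryagin-dual datum, any rank). Sequel of
`…GrowthFinite` (the door `0 < #I_{n+1}·#ker g_{n+1} < p^{pⁿ(p−1)}` ⟹ `μ = 0`; `#I_{n+1} ∣ g_n·#ker s_{n+1}`).

* §1 ★★ `exists_forall_natCard_growth_pos_and_le` — for EVERY finitely generated torsion `Λ`-module `X` with `μ(X) = 0` there are `n₀` and `B > 0` with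
  **`0 < g_n ≤ B` for all `n ≥ n₀`** (`g_n = #(ω_nX/ω_{n+1}X)`): `g_n ∣ #(X/Ψ_nX) = p^{λ(f)}·#(F/Ψ_nF) ≤ p^{λ(f)}·#F` once `λ(f) < pⁿ(p−1)` (gen 55's count with the largest
  finite submodule `F`, gen 56's `g_n ≤ #(X/Ψ_nX)`), with `B = p^{λ(f)}·#F` — no rank-`0`, regularity or «no finite submodule» hypothesis.
* §2 ★★★ `exists_natCard_map_selmerLayer_mul_kerG_lt_of_mu_eq_zero` / `mu_eq_zero_iff_exists_natCard_map_selmerLayer_mul_kerG_lt` — with the displayed hypotheses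
  «`∃ T, ∀ n, 0 < #ker h_n ≤ T`» and «`∃ C, ∀ n, 0 < #ker g_n ≤ C`» (`h_n` restriction `H¹(K_n, E[p^∞]) → H¹(K_∞, E[p^∞])`, `ker g_n = A_n/Sel_n`; in print for
  the cyclotomic tower: Greenberg's Lemmas 3.1–3.3): **`μ(X(E/K_∞)) = 0 ⟺ ∃ n, 0 < #((conj_{γ^{pⁿ}} − 1)·Sel_{p^∞}(E/K_{n+1})) · #ker g_{n+1} < p^{pⁿ(p−1)}`**
  (`⟹`: `#I_{n+1} ∣ g_n·#ker s_{n+1} ≤ B·T`, `B·T·C < 2^{B·T·C} ≤ p^{pⁿ(p−1)}` for large `n`; `⟸`: file I).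
What is NOT claimed: nothing about any curve; the boundedness hypotheses are displayed, not discharged; C2 untouched.
Memo `Cruxes/MainConjectureOfRankZeroBSDAtTwo/GROWTH-FINITE-att-p5-g57.md`.

References: R. Greenberg, LNM 1716 (1999), §1 pp. 60–65, Thm. 1.10, Conj. 1.11, §3 Lemmas 3.1–3.3, §4 Lemma 4.3 and p. 117 (the largest finite submodule)
[GreenbergLNM1716]; L. Washington, GTM 83, §13.3 Thm. 13.13 [Washington1997]; B. Mazur, Invent. Math. 18 (1972) §6 [Mazur1972].
-/

set_option linter.dupNamespace false
set_option autoImplicit false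

noncomputable section

open scoped Classical AddSubgroup Polynomial

universe u

namespace Summit.BirchSwinnertonDyer.BirchSwinnertonDyer.Theorems.AlignedTransportAtTwoHalfDescentLayerIndexGrowthFiniteComplete

open WeierstrassCurve Literature.NumberTheory.EllipticCurves Literature.NumberTheory.EllipticCurves.IwasawaDual
  Literature.NumberTheory.EllipticCurves.IwasawaAlgebra
  Summit.BirchSwinnertonDyer.Rank1Residual.X1.MuLambda
  Summit.BirchSwinnertonDyer.Rank1Residual.X1.GeneratorBoundMu
  Summit.BirchSwinnertonDyer.Rank1Residual.Iwasawa
  Summit.BirchSwinnertonDyer.BirchSwinnertonDyer.Theorems.DefectPrime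
  Summit.BirchSwinnertonDyer.BirchSwinnertonDyer.Theorems.AlignedTransportAtTwoCyclotomicLayerPrime
  Summit.BirchSwinnertonDyer.BirchSwinnertonDyer.Theorems.AlignedTransportAtTwoHalfDescentLayerIndex
  Summit.BirchSwinnertonDyer.BirchSwinnertonDyer.Theorems.AlignedTransportAtTwoHalfDescentLayerIndexFinite
  Summit.BirchSwinnertonDyer.BirchSwinnertonDyer.Theorems.AlignedTransportAtTwoHalfDescentLayerIndexBounded
  Summit.BirchSwinnertonDyer.BirchSwinnertonDyer.Theorems.AlignedTransportAtTwoHalfDescentLayerIndexGrowth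
  Summit.BirchSwinnertonDyer.BirchSwinnertonDyer.Theorems.AlignedTransportAtTwoHalfDescentLayerIndexGrowthDual
  Summit.BirchSwinnertonDyer.BirchSwinnertonDyer.Theorems.AlignedTransportAtTwoHalfDescentLayerIndexGrowthFinite

/-! ## §1 `μ = 0` ⟹ the growth numbers are eventually positive and bounded (any f.g. torsion `X`, any tower) -/

section Module

variable {p : ℕ} [hp : Fact p.Prime] {M : Type u} [AddCommGroup M] [Module (IwasawaAlgebra p) M]

/-- ★★ **`μ(X) = 0` ⟹ `∃ n₀ B > 0, ∀ n ≥ n₀: 0 < g_n ≤ B`** for EVERY finitely generated torsion `Λ`-module `X` (no tower, regularity or finite-submodule hypothesis):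
with `char X = (f)`, `F` the largest finite submodule and `λ(f) < pⁿ(p−1)`, `g_n ∣ #(X/Ψ_nX) = p^{λ(f)}·#(F/Ψ_nF) ≤ p^{λ(f)}·#F` (gen 55's count, `μ(f) = 0`) and `g_n > 0`.
[cite: Washington1997, §13.3 Thm. 13.13] [cite: GreenbergLNM1716, Thm. 1.10] -/
theorem exists_forall_natCard_growth_pos_and_le [Module.Finite (IwasawaAlgebra p) M] (hM : Module.IsTorsion (IwasawaAlgebra p) M) (hμ : muInvariant p M = 0) :
    ∃ n₀ B : ℕ, 0 < B ∧ ∀ n, n₀ ≤ n →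
      0 < Nat.card (↥(Ideal.span {((1 + PowerSeries.X : PowerSeries ℤ_[p]) ^ (p ^ n) - 1 : IwasawaAlgebra p)} • ⊤ : Submodule (IwasawaAlgebra p) M) ⧸
          (Ideal.span {(((Polynomial.cyclotomic (p ^ (n + 1)) ℤ_[p]).comp (Polynomial.X + 1) : ℤ_[p][X]) : IwasawaAlgebra p)} • ⊤ :
            Submodule (IwasawaAlgebra p) ↥(Ideal.span {((1 + PowerSeries.X : PowerSeries ℤ_[p]) ^ (p ^ n) - 1 : IwasawaAlgebra p)} • ⊤ :
              Submodule (IwasawaAlgebra p) M))) ∧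
      Nat.card (↥(Ideal.span {((1 + PowerSeries.X : PowerSeries ℤ_[p]) ^ (p ^ n) - 1 : IwasawaAlgebra p)} • ⊤ : Submodule (IwasawaAlgebra p) M) ⧸
          (Ideal.span {(((Polynomial.cyclotomic (p ^ (n + 1)) ℤ_[p]).comp (Polynomial.X + 1) : ℤ_[p][X]) : IwasawaAlgebra p)} • ⊤ :
            Submodule (IwasawaAlgebra p) ↥(Ideal.span {((1 + PowerSeries.X : PowerSeries ℤ_[p]) ^ (p ^ n) - 1 : IwasawaAlgebra p)} • ⊤ :
              Submodule (IwasawaAlgebra p) M))) ≤ B := by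
  haveI : IsNoetherian (IwasawaAlgebra p) M := inferInstance
  obtain ⟨f, hf0, hchar⟩ := exists_charGenerator_ne_zero M hM
  have hmu : mu f = 0 := by rw [Summit.BirchSwinnertonDyer.Rank1Residual.X1.MuPart.mu_generator_eq_muInvariant M hM hf0 hchar]; exact hμ
  obtain ⟨F, hFfin, hFmax⟩ := exists_finite_submodule_forall_finite_le (R := IwasawaAlgebra p) (M := M)
  haveI : Finite F := hFfin
  have hF := forall_finite_eq_bot_quotient_of_forall_finite_le F hFmax
  obtain ⟨n₀, -, hn₀⟩ := exists_linear_lt_pow (p := p) 0 (lam f) 0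
  rw [zero_mul, zero_add] at hn₀
  refine ⟨n₀, p ^ lam f * Nat.card F, Nat.mul_pos (pow_pos hp.out.pos _) Nat.card_pos, fun n hn ↦ ?_⟩
  have hlam : lam f < p ^ n * (p - 1) := hn₀.trans_le (Nat.mul_le_mul_right _ (Nat.pow_le_pow_right hp.out.pos hn))
  have hcount := natCard_layerQuotient_eq_pow_mul hM F hF hchar hlam
  rw [hmu, mul_zero, zero_add] at hcount
  haveI : Finite (F ⧸ (Ideal.span {(((Polynomial.cyclotomic (p ^ (n + 1)) ℤ_[p]).comp (Polynomial.X + 1) : ℤ_[p][X]) : IwasawaAlgebra p)} • ⊤ :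
      Submodule (IwasawaAlgebra p) F)) := Finite.of_surjective _ (Submodule.mkQ_surjective _)
  have hFq_pos : 0 < Nat.card (F ⧸ (Ideal.span {(((Polynomial.cyclotomic (p ^ (n + 1)) ℤ_[p]).comp (Polynomial.X + 1) : ℤ_[p][X]) : IwasawaAlgebra p)} • ⊤ :
      Submodule (IwasawaAlgebra p) F)) := Nat.card_pos
  have hFq_le : Nat.card (F ⧸ (Ideal.span {(((Polynomial.cyclotomic (p ^ (n + 1)) ℤ_[p]).comp (Polynomial.X + 1) : ℤ_[p][X]) : IwasawaAlgebra p)} • ⊤ :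
      Submodule (IwasawaAlgebra p) F)) ≤ Nat.card F := Nat.card_le_card_of_surjective _ (Submodule.mkQ_surjective _)
  have hpos : 0 < Nat.card (M ⧸ (Ideal.span {(((Polynomial.cyclotomic (p ^ (n + 1)) ℤ_[p]).comp (Polynomial.X + 1) : ℤ_[p][X]) : IwasawaAlgebra p)} • ⊤ :
      Submodule (IwasawaAlgebra p) M)) := by
    rw [hcount]
    exact Nat.mul_pos (pow_pos hp.out.pos _) hFq_pos
  obtain ⟨hgpos, hgle⟩ := natCard_growth_pos_and_le_of_natCard_layerQuotient_pos (M := M) hpos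
  refine ⟨hgpos, hgle.trans ?_⟩
  rw [hcount]
  exact Nat.mul_le_mul_left _ hFq_le

end Module

/-! ## §2 Completeness of the finite-level door under bounded control -/

section Selmer

variable {K : Type u} [Field K] [NumberField K] (W : WeierstrassCurve K) {p : ℕ} [hp : Fact p.Prime] (κ : ZpExtension K p)
  {γ : Field.absoluteGaloisGroup K}

/-- ★★★ **COMPLETENESS OF THE FINITE-LEVEL DOOR.** `E/K`, `κ` any `ℤ_p`-extension with topological generator `γ`, `D` any Pontryagin-dual datum with `X` f.g. torsion, and
BOUNDED CONTROL: the restriction kernels `ker h_n` and Greenberg's control kernels `ker g_n = A_n/Sel_n` are finite and bounded up the tower (displayed hypotheses; in print: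
Greenberg's Lemmas 3.1–3.3 for the cyclotomic tower). If **`μ(X(E/K_∞)) = 0`** then at SOME layer `n` (indeed at every large one)
**`0 < #((conj_{γ^{pⁿ}} − 1)·Sel_{p^∞}(E/K_{n+1})) · #ker g_{n+1} < p^{pⁿ(p−1)}`** (`#I_{n+1} ∣ g_n·#ker s_{n+1} ≤ B·T` by §1 and file I, against `pⁿ(p−1) → ∞`).
[cite: GreenbergLNM1716, §3 Lemmas 3.1–3.3, §4 Lemma 4.3, Thm. 1.10, Conj. 1.11] [cite: Washington1997, §13.3 Thm. 13.13] -/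
theorem exists_natCard_map_selmerLayer_mul_kerG_lt_of_mu_eq_zero (hγ : κ.IsTopGenerator γ) (D : W.SelmerDualData κ γ) [Module.Finite (IwasawaAlgebra p) D.X]
    (hD : D.IsTorsion) (hμ : D.mu = 0)
    (hh : ∃ T : ℕ, ∀ n, 0 < Nat.card (W.layerToInfty κ n).ker ∧ Nat.card (W.layerToInfty κ n).ker ≤ T)
    (hg : ∃ C : ℕ, ∀ n, 0 < Nat.card (W.KerG κ n) ∧ Nat.card (W.KerG κ n) ≤ C) :
    ∃ n : ℕ, 0 < Nat.card ↥((W.selmerLayer κ (n + 1)).map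
          (W.conjH1 p (κ.layerSubgroup (n + 1)) (γ ^ p ^ n) - AddMonoidHom.id (W.subgroupH1 p (κ.layerSubgroup (n + 1))))) *
        Nat.card (W.KerG κ (n + 1)) ∧
      Nat.card ↥((W.selmerLayer κ (n + 1)).map
          (W.conjH1 p (κ.layerSubgroup (n + 1)) (γ ^ p ^ n) - AddMonoidHom.id (W.subgroupH1 p (κ.layerSubgroup (n + 1))))) *
        Nat.card (W.KerG κ (n + 1)) < p ^ (p ^ n * (p - 1)) := by
  obtain ⟨T, hT⟩ := hh
  obtain ⟨C, hC⟩ := hg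
  obtain ⟨n₀, B, -, hB⟩ := exists_forall_natCard_growth_pos_and_le (M := D.X) hD hμ
  obtain ⟨n, hn, hlt⟩ := exists_linear_lt_pow (p := p) 0 (B * T * C) n₀
  rw [zero_mul, zero_add] at hlt
  obtain ⟨-, hdvd⟩ := natCard_growth_mul_dvd_and_dvd W κ hγ D n
  obtain ⟨hgpos, hgle⟩ := hB n hn
  haveI : Finite (W.layerToInfty κ (n + 1)).ker := (Nat.card_pos_iff.mp (hT (n + 1)).1).2
  haveI : Finite ↥((W.layerToInfty κ (n + 1)).ker ⊓ W.selmerLayer κ (n + 1)) :=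
    Finite.of_injective _ (AddSubgroup.inclusion_injective (inf_le_left : (W.layerToInfty κ (n + 1)).ker ⊓ W.selmerLayer κ (n + 1) ≤ _))
  have hks_pos : 0 < Nat.card ↥((W.layerToInfty κ (n + 1)).ker ⊓ W.selmerLayer κ (n + 1)) := Nat.card_pos
  have hks_le : Nat.card ↥((W.layerToInfty κ (n + 1)).ker ⊓ W.selmerLayer κ (n + 1)) ≤ T :=
    (Nat.le_of_dvd (hT (n + 1)).1 (AddSubgroup.card_dvd_of_le inf_le_left)).trans (hT (n + 1)).2
  have hIpos := Nat.pos_of_dvd_of_pos hdvd (Nat.mul_pos hgpos hks_pos)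
  have hIle := (Nat.le_of_dvd (Nat.mul_pos hgpos hks_pos) hdvd).trans (Nat.mul_le_mul hgle hks_le)
  refine ⟨n, Nat.mul_pos hIpos (hC (n + 1)).1, ?_⟩
  calc _ ≤ B * T * C := Nat.mul_le_mul hIle (hC (n + 1)).2
    _ < 2 ^ (B * T * C) := Nat.lt_two_pow_self
    _ ≤ p ^ (B * T * C) := Nat.pow_le_pow_left hp.out.two_le _
    _ ≤ p ^ (p ^ n * (p - 1)) := Nat.pow_le_pow_right hp.out.pos hlt.le

/-- ★★★ **THE FINITE-LEVEL DOOR IS COMPLETE UNDER BOUNDED CONTROL: `μ(X(E/K_∞)) = 0 ⟺ ∃ n, 0 < #((conj_{γ^{pⁿ}} − 1)·Sel_{p^∞}(E/K_{n+1})) · #ker g_{n+1} < p^{pⁿ(p−1)}`**,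
for EVERY dual datum with `X` f.g. torsion over ANY `ℤ_p`-extension whose restriction kernels and control kernels are finite and bounded (any rank).
[cite: GreenbergLNM1716, §3 Lemmas 3.1–3.3, §4 Lemma 4.3, Conj. 1.11] [cite: Washington1997, §13.3 Thm. 13.13] -/
theorem mu_eq_zero_iff_exists_natCard_map_selmerLayer_mul_kerG_lt (hγ : κ.IsTopGenerator γ) (D : W.SelmerDualData κ γ) [Module.Finite (IwasawaAlgebra p) D.X]
    (hD : D.IsTorsion) (hh : ∃ T : ℕ, ∀ n, 0 < Nat.card (W.layerToInfty κ n).ker ∧ Nat.card (W.layerToInfty κ n).ker ≤ T)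
    (hg : ∃ C : ℕ, ∀ n, 0 < Nat.card (W.KerG κ n) ∧ Nat.card (W.KerG κ n) ≤ C) :
    D.mu = 0 ↔ ∃ n : ℕ, 0 < Nat.card ↥((W.selmerLayer κ (n + 1)).map
          (W.conjH1 p (κ.layerSubgroup (n + 1)) (γ ^ p ^ n) - AddMonoidHom.id (W.subgroupH1 p (κ.layerSubgroup (n + 1))))) *
        Nat.card (W.KerG κ (n + 1)) ∧
      Nat.card ↥((W.selmerLayer κ (n + 1)).map
          (W.conjH1 p (κ.layerSubgroup (n + 1)) (γ ^ p ^ n) - AddMonoidHom.id (W.subgroupH1 p (κ.layerSubgroup (n + 1))))) *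
        Nat.card (W.KerG κ (n + 1)) < p ^ (p ^ n * (p - 1)) :=
  ⟨fun hμ ↦ exists_natCard_map_selmerLayer_mul_kerG_lt_of_mu_eq_zero W κ hγ D hD hμ hh hg,
    fun ⟨_, hpos, hlt⟩ ↦ mu_eq_zero_of_natCard_map_selmerLayer_mul_kerG_lt W κ hγ D hD hpos hlt⟩

end Selmer

end Summit.BirchSwinnertonDyer.BirchSwinnertonDyer.Theorems.AlignedTransportAtTwoHalfDescentLayerIndexGrowthFiniteComplete

end
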